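import Summits.BirchSwinnertonDyer.BirchSwinnertonDyer.Theorems.ShaPrimaryTransferFiniteShaComponentTransferSelmerCubicE2KRow
import Summits.BirchSwinnertonDyer.BirchSwinnertonDyer.Theorems.ShaPrimaryTransferFiniteShaComponentTransferSelmerCubicKillResidue
import HarnessLib

/-!
# BirchSwinnertonDyer — SEL2CUBIC door for the `checkE2K` / `checkE2KV` census rows: the `K`-free row shapes

HONEST FRAMING: route `ShaPrimaryTransfer`, seat `bsd-line-spt-p1` (g30), `--supports` item T =
`FiniteShaComponentTransfer` (stmt-22356), UNCHANGED (conjecture-grade at corank ≥ 2). BSD in rank ≥ 2 is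
NOT proved by any of this. THEOREMS ONLY.

The wrappers of `sha_door_of_checkE2KV` (`…SelmerCubicE2KRow`) in the exact argument shapes of the census rows:
* `sha_door_of_certsE2KV`, `shaCorank_two_eq_zero_of_certsE2KV_scaled`, `…_complSq`, `sha_door_of_certsE2KV_plain`
  — the shapes of `rank_eq_of_certsE2KV{,_scaled,_complSq,_plain}` with the kill hypothesis `hk` in RESIDUE form
  (in place of `KillValidE2`), assembled kill by kill by **`killResidueE2_nil`** / **`killResidueE2_cons`** from
  `killResidue_of_<shape> … (by decide +kernel)` (`…KillResidue`) — the census certificates UNCHANGED;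
* `checkE2KV_of_checkE2K`, `killResidueE2_of_search` and `sha_door_of_certsE2K`,
  `shaCorank_two_eq_zero_of_certsE2K_scaled`, `…_complSq`, `sha_door_of_certsE2K_plain` — the shapes of the
  monolithic rows `rank_eq_of_certsE2K{,_scaled,_complSq,_plain}` (`hk : killSearchE2 … = true`, residue trees at
  `p ≤ 23`, soundness `killCheck_sound_mod`).
Every such census row becomes an unconditional `t₂(E) = 0 ∧ rank E(ℚ) = r` door by swapping theorem names.
[cite: Cassels1991LecturesEllipticCurves, §15] [cite: SilvermanAEC2009, Thm. X.4.2, Rem. X.4.1]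
[cite: CremonaAlgorithms1997, §3.6]
-/

-- single-conjunct summit: `Summit.BirchSwinnertonDyer.BirchSwinnertonDyer.…` repeats the name by design
set_option linter.dupNamespace false

noncomputable section

open scoped Classical NumberField nonZeroDivisors

open Literature.NumberTheory.NumberFields Literature.NumberTheory.EllipticCurves
  Literature.NumberTheory.GaloisRepresentations Polynomial Module NumberField IsDedekindDomain Ideal
open WeierstrassCurve WeierstrassCurve.Affine

namespace Summit.BirchSwinnertonDyer.BirchSwinnertonDyer.Theorems.ShaPrimaryTransferSelmerCubicCover

open Summit.BirchSwinnertonDyer.BirchSwinnertonDyer.Rank2Observatory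
open Summit.BirchSwinnertonDyer.BirchSwinnertonDyer.Rank2Observatory.TwoDescCubic
open Summit.BirchSwinnertonDyer.BirchSwinnertonDyer.Rank2Observatory.TwoDescCl
open Summit.BirchSwinnertonDyer.BirchSwinnertonDyer.Rank2Observatory.TwoDescCl.ClFieldCert
open Summit.BirchSwinnertonDyer.BirchSwinnertonDyer.Rank2Observatory.TwoDescKill
open Summit.BirchSwinnertonDyer.BirchSwinnertonDyer.Theorems.ShaPrimaryTransferSelmerCubicKill

/-! ## `K`-free wrappers (the census rows' shapes) -/

section Rows

/-- **`K`-free door shape** (model `(0, A, 0, B, C)` read over `ℚ` from `ℤ`), in the exact shape of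
`rank_eq_of_certsE2KV` (`hk` in residue form): the row's arguments unchanged, the theorem name swapped.
[cite: Cassels1991LecturesEllipticCurves, §15] [cite: CremonaAlgorithms1997, §3.6] -/
theorem sha_door_of_certsE2KV (r : ℕ) (F : ClFieldCertE2) (cc : ClCurveCertE2) (ks : List ClKillE2)
    (h2 : F.check2 = true)
    (hpr : F.fe.primeListE.Forall Nat.Prime) (hc : checkE2KV F cc r ks = true)
    (hk : ∀ k ∈ ks, k.p.Prime ∧ ∃ N : ℕ, ∀ v : ℤ × ℤ × ℤ × ℤ,
      ¬ ((k.p : ℤ) ∣ v.1 ∧ (k.p : ℤ) ∣ v.2.1 ∧ (k.p : ℤ) ∣ v.2.2.1 ∧ (k.p : ℤ) ∣ v.2.2.2) →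
      (k.p : ℤ) ^ N ∣ (killQ F.fe.base.a F.fe.base.b F.fe.base.c (k.z F cc) cc.Xt.2.1 cc.Xt.2.2 v).1 →
      (k.p : ℤ) ^ N ∣ (killQ F.fe.base.a F.fe.base.b F.fe.base.c (k.z F cc) cc.Xt.2.1 cc.Xt.2.2 v).2 → False)
    (hlow : r ≤ (((⟨0, cc.A, 0, cc.B, cc.C⟩ : WeierstrassCurve ℤ)).map (Int.castRingHom ℚ)).mordellWeilRank) :
    (((⟨0, cc.A, 0, cc.B, cc.C⟩ : WeierstrassCurve ℤ)).map (Int.castRingHom ℚ)).shaCorank 2 = 0 ∧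
      AddCommGroup.primaryComponent (((⟨0, cc.A, 0, cc.B, cc.C⟩ : WeierstrassCurve ℤ)).map (Int.castRingHom ℚ)).sha 2 = ⊥ ∧
        (((⟨0, cc.A, 0, cc.B, cc.C⟩ : WeierstrassCurve ℤ)).map (Int.castRingHom ℚ)).mordellWeilRank = r := by
  haveI : Fact (Irreducible (MonicCubic.polyQ F.fe.base.a F.fe.base.b F.fe.base.c)) :=
    ⟨F.fe.base.irreducible_of_field (F.fe.checkField_of_checkE (F.checkE_of_check2 h2))⟩
  exact sha_door_map_of_door (fun h => sha_door_of_checkE2KV (K := CubicField F.fe.base.a F.fe.base.b F.fe.base.c) r F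
      (CubicField.aeval_root _ _ _) (CubicField.finrank_eq _ _ _) h2 hpr cc ks hc hk h) hlow

/-- `Δ ≠ 0` is the first clause of `checkE2KV`. [folklore] -/
theorem deltaShort_ne_of_checkE2KV {r : ℕ} {F : ClFieldCertE2} {cc : ClCurveCertE2} {ks : List ClKillE2}
    (hc : checkE2KV F cc r ks = true) : deltaShort cc.A cc.B cc.C ≠ 0 := by
  simp only [checkE2KV, Bool.and_eq_true, decide_eq_true_eq] at hc
  exact hc.1.1.1.1.1.1.1.1.1.1.1.1.1.1.1.1.1.1

/-- **`t₂(E) = 0 ∧ rank E(ℚ) = r` for the ORIGINAL model** `(a₁, a₂, a₃, a₄, a₆)` when the records certify its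
completed-square model RESCALED by `d` (`t₂` and the rank are invariant under the change of variables), in the shape
of `rank_eq_of_certsE2KV_scaled`. [cite: CremonaAlgorithms1997, §3.6] [cite: SilvermanAEC2009, III.3.1(b), Thm. X.4.2] -/
theorem shaCorank_two_eq_zero_of_certsE2KV_scaled (r : ℕ) (F : ClFieldCertE2) (cc : ClCurveCertE2) (ks : List ClKillE2)
    (h2 : F.check2 = true)
    (hpr : F.fe.primeListE.Forall Nat.Prime) (hc : checkE2KV F cc r ks = true)
    (hk : ∀ k ∈ ks, k.p.Prime ∧ ∃ N : ℕ, ∀ v : ℤ × ℤ × ℤ × ℤ,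
      ¬ ((k.p : ℤ) ∣ v.1 ∧ (k.p : ℤ) ∣ v.2.1 ∧ (k.p : ℤ) ∣ v.2.2.1 ∧ (k.p : ℤ) ∣ v.2.2.2) →
      (k.p : ℤ) ^ N ∣ (killQ F.fe.base.a F.fe.base.b F.fe.base.c (k.z F cc) cc.Xt.2.1 cc.Xt.2.2 v).1 →
      (k.p : ℤ) ^ N ∣ (killQ F.fe.base.a F.fe.base.b F.fe.base.c (k.z F cc) cc.Xt.2.1 cc.Xt.2.2 v).2 → False) (a₁ a₂ a₃ a₄ a₆ d : ℤ)
    (hd : d ≠ 0)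
    (hABC : cc.A = d ^ 2 * (a₁ ^ 2 + 4 * a₂) ∧ cc.B = d ^ 4 * (8 * (a₁ * a₃ + 2 * a₄)) ∧
      cc.C = d ^ 6 * (16 * (a₃ ^ 2 + 4 * a₆)))
    (hlow : r ≤ (((⟨a₁, a₂, a₃, a₄, a₆⟩ : WeierstrassCurve ℤ)).map (Int.castRingHom ℚ)).mordellWeilRank) :
    (((⟨a₁, a₂, a₃, a₄, a₆⟩ : WeierstrassCurve ℤ)).map (Int.castRingHom ℚ)).shaCorank 2 = 0 ∧
      (((⟨a₁, a₂, a₃, a₄, a₆⟩ : WeierstrassCurve ℤ)).map (Int.castRingHom ℚ)).mordellWeilRank = r := by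
  haveI : Fact (Irreducible (MonicCubic.polyQ F.fe.base.a F.fe.base.b F.fe.base.c)) :=
    ⟨F.fe.base.irreducible_of_field (F.fe.checkField_of_checkE (F.checkE_of_check2 h2))⟩
  exact shaCorank_two_transport_scaled a₁ a₂ a₃ a₄ a₆ d hd hABC (deltaShort_ne_of_checkE2KV hc)
    (fun h => sha_door_of_checkE2KV (K := CubicField F.fe.base.a F.fe.base.b F.fe.base.c) r F
      (CubicField.aeval_root _ _ _) (CubicField.finrank_eq _ _ _) h2 hpr cc ks hc hk h) hlow

/-- The plain completed-square shape (`d = 1`), in the shape of `rank_eq_of_certsE2KV_complSq`.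
[cite: CremonaAlgorithms1997, §3.6] [cite: SilvermanAEC2009, Thm. X.4.2] -/
theorem shaCorank_two_eq_zero_of_certsE2KV_complSq (r : ℕ) (F : ClFieldCertE2) (cc : ClCurveCertE2) (ks : List ClKillE2)
    (h2 : F.check2 = true)
    (hpr : F.fe.primeListE.Forall Nat.Prime) (hc : checkE2KV F cc r ks = true)
    (hk : ∀ k ∈ ks, k.p.Prime ∧ ∃ N : ℕ, ∀ v : ℤ × ℤ × ℤ × ℤ,
      ¬ ((k.p : ℤ) ∣ v.1 ∧ (k.p : ℤ) ∣ v.2.1 ∧ (k.p : ℤ) ∣ v.2.2.1 ∧ (k.p : ℤ) ∣ v.2.2.2) →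
      (k.p : ℤ) ^ N ∣ (killQ F.fe.base.a F.fe.base.b F.fe.base.c (k.z F cc) cc.Xt.2.1 cc.Xt.2.2 v).1 →
      (k.p : ℤ) ^ N ∣ (killQ F.fe.base.a F.fe.base.b F.fe.base.c (k.z F cc) cc.Xt.2.1 cc.Xt.2.2 v).2 → False) (a₁ a₂ a₃ a₄ a₆ : ℤ)
    (hABC : cc.A = a₁ ^ 2 + 4 * a₂ ∧ cc.B = 8 * (a₁ * a₃ + 2 * a₄) ∧ cc.C = 16 * (a₃ ^ 2 + 4 * a₆))
    (hlow : r ≤ (((⟨a₁, a₂, a₃, a₄, a₆⟩ : WeierstrassCurve ℤ)).map (Int.castRingHom ℚ)).mordellWeilRank) :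
    (((⟨a₁, a₂, a₃, a₄, a₆⟩ : WeierstrassCurve ℤ)).map (Int.castRingHom ℚ)).shaCorank 2 = 0 ∧
      (((⟨a₁, a₂, a₃, a₄, a₆⟩ : WeierstrassCurve ℤ)).map (Int.castRingHom ℚ)).mordellWeilRank = r := by
  haveI : Fact (Irreducible (MonicCubic.polyQ F.fe.base.a F.fe.base.b F.fe.base.c)) :=
    ⟨F.fe.base.irreducible_of_field (F.fe.checkField_of_checkE (F.checkE_of_check2 h2))⟩
  exact shaCorank_two_transport_complSq a₁ a₂ a₃ a₄ a₆ hABC (deltaShort_ne_of_checkE2KV hc)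
    (fun h => sha_door_of_checkE2KV (K := CubicField F.fe.base.a F.fe.base.b F.fe.base.c) r F
      (CubicField.aeval_root _ _ _) (CubicField.finrank_eq _ _ _) h2 hpr cc ks hc hk h) hlow

/-- Door plumbing for a curve already given by a plain model `y² = x³ + a₂x² + a₄x + a₆` (`a₁ = a₃ = 0`), in
the shape of `rank_eq_of_certsE2KV_plain`. [cite: Cassels1991LecturesEllipticCurves, §15] -/
theorem sha_door_of_certsE2KV_plain (r : ℕ) (F : ClFieldCertE2) (cc : ClCurveCertE2) (ks : List ClKillE2)
    (h2 : F.check2 = true)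
    (hpr : F.fe.primeListE.Forall Nat.Prime) (hc : checkE2KV F cc r ks = true)
    (hk : ∀ k ∈ ks, k.p.Prime ∧ ∃ N : ℕ, ∀ v : ℤ × ℤ × ℤ × ℤ,
      ¬ ((k.p : ℤ) ∣ v.1 ∧ (k.p : ℤ) ∣ v.2.1 ∧ (k.p : ℤ) ∣ v.2.2.1 ∧ (k.p : ℤ) ∣ v.2.2.2) →
      (k.p : ℤ) ^ N ∣ (killQ F.fe.base.a F.fe.base.b F.fe.base.c (k.z F cc) cc.Xt.2.1 cc.Xt.2.2 v).1 →
      (k.p : ℤ) ^ N ∣ (killQ F.fe.base.a F.fe.base.b F.fe.base.c (k.z F cc) cc.Xt.2.1 cc.Xt.2.2 v).2 → False) (a₂ a₄ a₆ : ℤ)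
    (hABC : cc.A = a₂ ∧ cc.B = a₄ ∧ cc.C = a₆)
    (hlow : r ≤ (((⟨0, a₂, 0, a₄, a₆⟩ : WeierstrassCurve ℤ)).map (Int.castRingHom ℚ)).mordellWeilRank) :
    (((⟨0, a₂, 0, a₄, a₆⟩ : WeierstrassCurve ℤ)).map (Int.castRingHom ℚ)).shaCorank 2 = 0 ∧
      AddCommGroup.primaryComponent ((((⟨0, a₂, 0, a₄, a₆⟩ : WeierstrassCurve ℤ)).map (Int.castRingHom ℚ))).sha 2
          = ⊥ ∧
        (((⟨0, a₂, 0, a₄, a₆⟩ : WeierstrassCurve ℤ)).map (Int.castRingHom ℚ)).mordellWeilRank = r := by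
  haveI : Fact (Irreducible (MonicCubic.polyQ F.fe.base.a F.fe.base.b F.fe.base.c)) :=
    ⟨F.fe.base.irreducible_of_field (F.fe.checkField_of_checkE (F.checkE_of_check2 h2))⟩
  exact sha_door_transport_plain a₂ a₄ a₆ hABC
    (fun h => sha_door_of_checkE2KV (K := CubicField F.fe.base.a F.fe.base.b F.fe.base.c) r F
      (CubicField.aeval_root _ _ _) (CubicField.finrank_eq _ _ _) h2 hpr cc ks hc hk h) hlow

/-! ## Row kit: the kill hypothesis kill by kill; the monolithic `checkE2K` / `killSearchE2` rows -/

/-- The kill hypothesis of the empty kill list. [folklore] -/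
theorem killResidueE2_nil {F : ClFieldCertE2} {cc : ClCurveCertE2} :
    ∀ k ∈ ([] : List ClKillE2), k.p.Prime ∧ ∃ N : ℕ, ∀ v : ℤ × ℤ × ℤ × ℤ,
      ¬ ((k.p : ℤ) ∣ v.1 ∧ (k.p : ℤ) ∣ v.2.1 ∧ (k.p : ℤ) ∣ v.2.2.1 ∧ (k.p : ℤ) ∣ v.2.2.2) →
      (k.p : ℤ) ^ N ∣ (killQ F.fe.base.a F.fe.base.b F.fe.base.c (k.z F cc) cc.Xt.2.1 cc.Xt.2.2 v).1 →
      (k.p : ℤ) ^ N ∣ (killQ F.fe.base.a F.fe.base.b F.fe.base.c (k.z F cc) cc.Xt.2.1 cc.Xt.2.2 v).2 → False := by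
  simp

/-- Prepend one kill: its prime is prime (`by norm_num`) and its class carries a residue certificate there, by
any certificate shape (`killResidue_of_killCheck`, `killResidue_of_sig3Check`, `killResidue_of_sig2xCheck`, …,
the census certificate `(by decide +kernel)` unchanged). [folklore] -/
theorem killResidueE2_cons {F : ClFieldCertE2} {cc : ClCurveCertE2} {k : ClKillE2} {ks : List ClKillE2}
    (hp : k.p.Prime)
    (h₁ : ∃ N : ℕ, ∀ v : ℤ × ℤ × ℤ × ℤ,
      ¬ ((k.p : ℤ) ∣ v.1 ∧ (k.p : ℤ) ∣ v.2.1 ∧ (k.p : ℤ) ∣ v.2.2.1 ∧ (k.p : ℤ) ∣ v.2.2.2) →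
      (k.p : ℤ) ^ N ∣ (killQ F.fe.base.a F.fe.base.b F.fe.base.c (k.z F cc) cc.Xt.2.1 cc.Xt.2.2 v).1 →
      (k.p : ℤ) ^ N ∣ (killQ F.fe.base.a F.fe.base.b F.fe.base.c (k.z F cc) cc.Xt.2.1 cc.Xt.2.2 v).2 → False)
    (h : ∀ k ∈ ks, k.p.Prime ∧ ∃ N : ℕ, ∀ v : ℤ × ℤ × ℤ × ℤ,
      ¬ ((k.p : ℤ) ∣ v.1 ∧ (k.p : ℤ) ∣ v.2.1 ∧ (k.p : ℤ) ∣ v.2.2.1 ∧ (k.p : ℤ) ∣ v.2.2.2) →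
      (k.p : ℤ) ^ N ∣ (killQ F.fe.base.a F.fe.base.b F.fe.base.c (k.z F cc) cc.Xt.2.1 cc.Xt.2.2 v).1 →
      (k.p : ℤ) ^ N ∣ (killQ F.fe.base.a F.fe.base.b F.fe.base.c (k.z F cc) cc.Xt.2.1 cc.Xt.2.2 v).2 → False) :
    ∀ k' ∈ k :: ks, k'.p.Prime ∧ ∃ N : ℕ, ∀ v : ℤ × ℤ × ℤ × ℤ,
      ¬ ((k'.p : ℤ) ∣ v.1 ∧ (k'.p : ℤ) ∣ v.2.1 ∧ (k'.p : ℤ) ∣ v.2.2.1 ∧ (k'.p : ℤ) ∣ v.2.2.2) →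
      (k'.p : ℤ) ^ N ∣ (killQ F.fe.base.a F.fe.base.b F.fe.base.c (k'.z F cc) cc.Xt.2.1 cc.Xt.2.2 v).1 →
      (k'.p : ℤ) ^ N ∣ (killQ F.fe.base.a F.fe.base.b F.fe.base.c (k'.z F cc) cc.Xt.2.1 cc.Xt.2.2 v).2 → False := by
  intro k' hk'
  rcases List.mem_cons.mp hk' with rfl | hm
  · exact ⟨hp, h₁⟩
  · exact h k' hm

/-- `checkE2K` (light clause `lite`: `p ∈ killPrimes ∧ z ≠ 0 ∧ class ≠ ∅`) implies `checkE2KV` (light clause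
`liteV`: `z ≠ 0 ∧ class ≠ ∅`), all other clauses identical. [folklore] -/
theorem checkE2KV_of_checkE2K {F : ClFieldCertE2} {cc : ClCurveCertE2} {r : ℕ} {ks : List ClKillE2}
    (hc : checkE2K F cc r ks = true) : checkE2KV F cc r ks = true := by
  simp only [checkE2K, Bool.and_eq_true] at hc
  obtain ⟨⟨hrest, hlite⟩, hcount⟩ := hc
  simp only [checkE2KV, Bool.and_eq_true]
  refine ⟨⟨hrest, ?_⟩, hcount⟩
  rw [List.all_eq_true] at hlite ⊢
  intro k hkm
  have h := hlite k hkm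
  simp only [ClKillE2.lite, ClKillE2.liteV, Bool.and_eq_true, decide_eq_true_eq] at h ⊢
  exact ⟨h.1.2, h.2⟩

/-- The monolithic residue searches `killSearchE2` (trees `killCheck` at primes `p ∈ killPrimes`, primality from
the light clauses of `checkE2K`) give the kill hypothesis in residue form (`killResidue_of_killCheck`, i.e.
`killCheck_sound_mod` with `N = fuel + 1`). [cite: CremonaAlgorithms1997, §3.6] -/
theorem killResidueE2_of_search {F : ClFieldCertE2} {cc : ClCurveCertE2} {r : ℕ} {ks : List ClKillE2}
    (hc : checkE2K F cc r ks = true) (hk : killSearchE2 F cc ks = true) :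
    ∀ k ∈ ks, k.p.Prime ∧ ∃ N : ℕ, ∀ v : ℤ × ℤ × ℤ × ℤ,
      ¬ ((k.p : ℤ) ∣ v.1 ∧ (k.p : ℤ) ∣ v.2.1 ∧ (k.p : ℤ) ∣ v.2.2.1 ∧ (k.p : ℤ) ∣ v.2.2.2) →
      (k.p : ℤ) ^ N ∣ (killQ F.fe.base.a F.fe.base.b F.fe.base.c (k.z F cc) cc.Xt.2.1 cc.Xt.2.2 v).1 →
      (k.p : ℤ) ^ N ∣ (killQ F.fe.base.a F.fe.base.b F.fe.base.c (k.z F cc) cc.Xt.2.1 cc.Xt.2.2 v).2 → False := by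
  simp only [checkE2K, Bool.and_eq_true] at hc
  obtain ⟨⟨-, hlite⟩, -⟩ := hc
  rw [List.all_eq_true] at hlite
  rw [killSearchE2, List.all_eq_true] at hk
  intro k hkm
  have h := hlite k hkm
  simp only [ClKillE2.lite, Bool.and_eq_true, decide_eq_true_eq] at h
  exact ⟨prime_of_mem_killPrimes h.1.1, killResidue_of_killCheck (prime_of_mem_killPrimes h.1.1) (hk k hkm)⟩

/-- **`K`-free door**, in the exact shape of `rank_eq_of_certsE2K` (`hk : killSearchE2 … = true`).
[cite: Cassels1991LecturesEllipticCurves, §15] [cite: CremonaAlgorithms1997, §3.6] -/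
theorem sha_door_of_certsE2K (r : ℕ) (F : ClFieldCertE2) (cc : ClCurveCertE2) (ks : List ClKillE2)
    (h2 : F.check2 = true) (hpr : F.fe.primeListE.Forall Nat.Prime) (hc : checkE2K F cc r ks = true)
    (hk : killSearchE2 F cc ks = true)
    (hlow : r ≤ (((⟨0, cc.A, 0, cc.B, cc.C⟩ : WeierstrassCurve ℤ)).map (Int.castRingHom ℚ)).mordellWeilRank) :
    (((⟨0, cc.A, 0, cc.B, cc.C⟩ : WeierstrassCurve ℤ)).map (Int.castRingHom ℚ)).shaCorank 2 = 0 ∧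
      AddCommGroup.primaryComponent (((⟨0, cc.A, 0, cc.B, cc.C⟩ : WeierstrassCurve ℤ)).map (Int.castRingHom ℚ)).sha 2 = ⊥ ∧
        (((⟨0, cc.A, 0, cc.B, cc.C⟩ : WeierstrassCurve ℤ)).map (Int.castRingHom ℚ)).mordellWeilRank = r :=
  sha_door_of_certsE2KV r F cc ks h2 hpr (checkE2KV_of_checkE2K hc) (killResidueE2_of_search hc hk) hlow

/-- In the shape of `rank_eq_of_certsE2K_scaled`. [cite: CremonaAlgorithms1997, §3.6] [cite: SilvermanAEC2009, Thm. X.4.2] -/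
theorem shaCorank_two_eq_zero_of_certsE2K_scaled (r : ℕ) (F : ClFieldCertE2) (cc : ClCurveCertE2)
    (ks : List ClKillE2) (h2 : F.check2 = true) (hpr : F.fe.primeListE.Forall Nat.Prime)
    (hc : checkE2K F cc r ks = true) (hk : killSearchE2 F cc ks = true) (a₁ a₂ a₃ a₄ a₆ d : ℤ) (hd : d ≠ 0)
    (hABC : cc.A = d ^ 2 * (a₁ ^ 2 + 4 * a₂) ∧ cc.B = d ^ 4 * (8 * (a₁ * a₃ + 2 * a₄)) ∧
      cc.C = d ^ 6 * (16 * (a₃ ^ 2 + 4 * a₆)))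
    (hlow : r ≤ (((⟨a₁, a₂, a₃, a₄, a₆⟩ : WeierstrassCurve ℤ)).map (Int.castRingHom ℚ)).mordellWeilRank) :
    (((⟨a₁, a₂, a₃, a₄, a₆⟩ : WeierstrassCurve ℤ)).map (Int.castRingHom ℚ)).shaCorank 2 = 0 ∧
      (((⟨a₁, a₂, a₃, a₄, a₆⟩ : WeierstrassCurve ℤ)).map (Int.castRingHom ℚ)).mordellWeilRank = r :=
  shaCorank_two_eq_zero_of_certsE2KV_scaled r F cc ks h2 hpr (checkE2KV_of_checkE2K hc)
    (killResidueE2_of_search hc hk) a₁ a₂ a₃ a₄ a₆ d hd hABC hlow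

/-- In the shape of `rank_eq_of_certsE2K_complSq`. [cite: CremonaAlgorithms1997, §3.6] [cite: SilvermanAEC2009, Thm. X.4.2] -/
theorem shaCorank_two_eq_zero_of_certsE2K_complSq (r : ℕ) (F : ClFieldCertE2) (cc : ClCurveCertE2)
    (ks : List ClKillE2) (h2 : F.check2 = true) (hpr : F.fe.primeListE.Forall Nat.Prime)
    (hc : checkE2K F cc r ks = true) (hk : killSearchE2 F cc ks = true) (a₁ a₂ a₃ a₄ a₆ : ℤ)
    (hABC : cc.A = a₁ ^ 2 + 4 * a₂ ∧ cc.B = 8 * (a₁ * a₃ + 2 * a₄) ∧ cc.C = 16 * (a₃ ^ 2 + 4 * a₆))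
    (hlow : r ≤ (((⟨a₁, a₂, a₃, a₄, a₆⟩ : WeierstrassCurve ℤ)).map (Int.castRingHom ℚ)).mordellWeilRank) :
    (((⟨a₁, a₂, a₃, a₄, a₆⟩ : WeierstrassCurve ℤ)).map (Int.castRingHom ℚ)).shaCorank 2 = 0 ∧
      (((⟨a₁, a₂, a₃, a₄, a₆⟩ : WeierstrassCurve ℤ)).map (Int.castRingHom ℚ)).mordellWeilRank = r :=
  shaCorank_two_eq_zero_of_certsE2KV_complSq r F cc ks h2 hpr (checkE2KV_of_checkE2K hc)
    (killResidueE2_of_search hc hk) a₁ a₂ a₃ a₄ a₆ hABC hlow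

/-- In the shape of `rank_eq_of_certsE2K_plain`. [cite: Cassels1991LecturesEllipticCurves, §15] -/
theorem sha_door_of_certsE2K_plain (r : ℕ) (F : ClFieldCertE2) (cc : ClCurveCertE2) (ks : List ClKillE2)
    (h2 : F.check2 = true) (hpr : F.fe.primeListE.Forall Nat.Prime) (hc : checkE2K F cc r ks = true)
    (hk : killSearchE2 F cc ks = true) (a₂ a₄ a₆ : ℤ) (hABC : cc.A = a₂ ∧ cc.B = a₄ ∧ cc.C = a₆)
    (hlow : r ≤ (((⟨0, a₂, 0, a₄, a₆⟩ : WeierstrassCurve ℤ)).map (Int.castRingHom ℚ)).mordellWeilRank) :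
    (((⟨0, a₂, 0, a₄, a₆⟩ : WeierstrassCurve ℤ)).map (Int.castRingHom ℚ)).shaCorank 2 = 0 ∧
      AddCommGroup.primaryComponent ((((⟨0, a₂, 0, a₄, a₆⟩ : WeierstrassCurve ℤ)).map (Int.castRingHom ℚ))).sha 2
          = ⊥ ∧
        (((⟨0, a₂, 0, a₄, a₆⟩ : WeierstrassCurve ℤ)).map (Int.castRingHom ℚ)).mordellWeilRank = r :=
  sha_door_of_certsE2KV_plain r F cc ks h2 hpr (checkE2KV_of_checkE2K hc) (killResidueE2_of_search hc hk) a₂ a₄ a₆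
    hABC hlow

end Rows

end Summit.BirchSwinnertonDyer.BirchSwinnertonDyer.Theorems.ShaPrimaryTransferSelmerCubicCover

end
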